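import Literature.Probability.RandomPlanarGeometry.HexSAWLemma2
import HarnessLib

/-!
# Glazman–Manolescu, Lemma 4.1: the parafermionic identity in an equilateral triangle

Topic `Literature/Probability/RandomPlanarGeometry`; first support file for the discharge of the
named fact `Literature.Probability.RandomPlanarGeometry.SAW.YangBaxter.GlazmanManolescu2019_prop11_limit`
(`YangBaxterSAWTwoPoint.lean`): "the partition function of self-avoiding bridges on the hexagonal
lattice vanishes at infinity: `B_T(π/3) → 0` as `T → ∞`" (A. Glazman, I. Manolescu,
*Self-avoiding walk on `ℤ²` with Yang–Baxter weights: universality of critical fugacity and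
2-point function*, Ann. Inst. Henri Poincaré Probab. Stat. 56 (2020), arXiv:1708.00395,
Proposition 1.1; originally [BBDDG]). The printed proof (§4.1, pp. 10–11) takes place on the
hexagonal lattice and uses its rotational symmetry; it is formalised in the coordinate model
`HV = ℤ × ℤ × Bool` of the honeycomb lattice of the Duminil-Copin–Smirnov development
(`HexSAWLattice.lean` … `HexSAWLemma2.lean`), whose conventions we keep: the half-plane is
`{x₁ ≥ 0}`, the starting mid-edge `a` is the vertical edge `{w, O}` below the origin
`O = (0, 0, false)`, walks are the vertex lists `HV.IsMidWalk`, weights are `x_c^{ℓ}`.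

This file proves **Lemma 4.1** (p. 10): "Consider the strip `S_{2L+1}(π/3)` … and inscribe
inside it an equilateral triangle `T_L` of side-length `2L+1` in such a way that the midpoint of
its vertical side is `0`. Let `A^Δ_{2L+1}` be the partition function of walks starting at `0`,
contained in the triangle, and ending on its left side; write `D^Δ_{2L+1}` for the partition
function of walks ending on any of the two other sides of the triangle. … By summing the real
part of (CR) … `cos(3π/8) A^Δ_{2L+1} + cos(π/8) D^Δ_{2L+1} = 1`. All walks contributing to
`A^Δ_{2L+1}` also contribute to `A^Δ_{2L+3}`, which implies that `A^Δ_{2L+1}` is increasing in `L`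
… `D^Δ_{2L+1}` is decreasing in `L`. Moreover `A^Δ_{2L+1} ≤ A_{2L+1}` … `B_{2L+1} ≤ cos(π/8) D^Δ_{2L+1}`."

## Contents (namespace `Literature.Probability.RandomPlanarGeometry.SAW.HV`)

* `triV L` — the vertex set of the triangle `T_L`: the `(2L+1)²` triangular cells
  `{0 ≤ x₁, -L ≤ x₀, x₀ + x₁ + b ≤ L}` of the lattice triangle with corners (hexagon centres)
  `(-L, 0)`, `(L+1, 0)`, `(-L, 2L+1)`; its base lies on the boundary line of the half-plane and is
  centred at `a`; `triV L ⊆ stripV (2L+1) L` (`triV_subset_stripV`).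
* `IsLeftDart L`, `IsRightDart L` — the final half-edge crosses the left side (from
  `(-L, x₁, false)` to `(-L-1, x₁, true)`, direction `-2 + ω`) resp. the right side (from
  `(x₀, x₁, false)`, `x₀ + x₁ = L`, to `(x₀, x₁, true)`, direction `1 + ω`); together with the
  base class `IsAlphaDart` of `HexSAWStrip.lean` these are all the boundary half-edges
  (`not_mem_triV_iff_classes`, `tri_boundary_iff`).
* `pturn_of_isLeftDart` (`= +1`, winding `+π/3`), `pturn_of_isRightDart` (`= -1`, winding
  `-π/3`): Hopf's formula `pturn_walk_eq` (`HexSAWHopfPath.lean`) with the rotations `1 - ω`,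
  `ω`; `boundaryTerm_re_of_isLeftDart/RightDart`: the boundary terms have real part `cos(π/8)`
  ("each walk ending on `β^Δ` has total weight `cos(π/8)`", caption of Fig. 7).
* `triA L` (`A^Δ`), `triDl L`, `triDr L` (the two halves of `D^Δ`) and **`tri_identity`**:
  `cos(3π/8) · triA L + cos(π/8) · (triDl L + triDr L) = 1` (from `HV.boundary_sum`, Lemma 1 summed
  over `V(T_L)`).
* `reflT` — the reflection of `ℍ` in the vertical axis of `a` (`(x₀, x₁, b) ↦ (-x₀-x₁-b, x₁, b)`),
  a graph automorphism fixing `w`, `O` and `T_L` and exchanging the two far sides, whence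
  `triDl_eq_triDr` ("by vertical symmetry, `D^Δ = 2 Σ_K Δ^Δ_{L,K}`", p. 10);
* `triA_mono`, `triDl_antitone` (monotonicity in `L`), `triA_le_stripA` (`A^Δ ≤ A_{T,L'}` for
  `T ≥ 2L+1`), and **`stripB_le_triDl`**: `B_{T,L'} ≤ 2 cos(π/8) · triDl L` for every `T ≥ 2L+1` and
  every `L'` — Lemma 4.1's inequality (4.1), with DCS's finite-volume `B_{T,L'}` and Lemma 2
  (`1 = c_α A + B + c_ε E`, `E ≥ 0`) in place of the infinite-strip identity (2.5).

The decay `triDl L → 0` (Proposition 1.1) is proved in `HexSAWBridgeDecay.lean` by the rotation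
argument of §4.1, and transferred to the Yang–Baxter encoding of `YangBaxterSAW.lean` afterwards.
-/

noncomputable section

open Finset

namespace Literature.Probability.RandomPlanarGeometry.SAW

namespace HV

open Real Hopf

/-! ### Two more arguments of lattice directions -/

/-- `ω̄ = 1 - ω` (`ω = e^{iπ/3}` has real part `1/2`). [folklore] -/
theorem conj_omg_eq : (starRingEnd ℂ) omg = 1 - omg := by
  apply Complex.ext
  · rw [Complex.conj_re, Complex.sub_re, Complex.one_re, omg_re]; norm_num
  · rw [Complex.conj_im, Complex.sub_im, Complex.one_im, omg_im]; ring

/-- `arg (1 - ω) = -π/3`. [folklore] -/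
theorem arg_one_sub_omg : Complex.arg (1 - omg) = -(π / 3) := by
  rw [← conj_omg_eq, arg_conj_omg]

/-- `1 - ω ≠ 0`. [folklore] -/
theorem one_sub_omg_ne_zero : (1 : ℂ) - omg ≠ 0 := by
  rw [← conj_omg_eq, map_ne_zero]; exact omg_ne_zero

/-- Multiplying a nonzero vector of the closed upper half-plane by `ω̄ = 1 - ω` subtracts `π/3`
from its argument. [folklore] -/
theorem arg_one_sub_omg_mul {D : ℂ} (hD : D ≠ 0) (hb : 0 ≤ D.im) :
    Complex.arg ((1 - omg) * D) = Complex.arg D - π / 3 := by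
  have h0 : 0 ≤ Complex.arg D := Complex.arg_nonneg_iff.2 hb
  rw [(Complex.arg_mul_eq_add_arg_iff one_sub_omg_ne_zero hD).2, arg_one_sub_omg]; · ring
  rw [arg_one_sub_omg]
  constructor <;> linarith [Complex.arg_le_pi D, Real.pi_pos]

/-- Arguments add under multiplication when both factors and the product lie in the closed upper
half-plane and the first factor is not a negative real. [folklore] -/
theorem arg_mul_eq_add_of_im_nonneg {c z : ℂ} (hc : c ≠ 0) (hz : z ≠ 0) (hc0 : 0 ≤ c.im)
    (hcπ : Complex.arg c < π) (hz0 : 0 ≤ z.im) (hcz : 0 ≤ (c * z).im) :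
    Complex.arg (c * z) = Complex.arg c + Complex.arg z := by
  have h := Complex.arg_mul_coe_angle hc hz
  rw [← Real.Angle.coe_add] at h
  obtain ⟨k, hk⟩ := Real.Angle.angle_eq_iff_two_pi_dvd_sub.1 h
  have h1 : 0 ≤ Complex.arg c := Complex.arg_nonneg_iff.2 hc0
  have h2 : 0 ≤ Complex.arg z := Complex.arg_nonneg_iff.2 hz0
  have h3 : 0 ≤ Complex.arg (c * z) := Complex.arg_nonneg_iff.2 hcz
  have h4 := Complex.arg_le_pi z
  have h5 := Complex.arg_le_pi (c * z)
  have hπ := Real.pi_pos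
  have hk1 : (k : ℝ) < 1 := by
    by_contra hk1
    push Not at hk1
    have : 2 * π * 1 ≤ 2 * π * (k : ℝ) := by gcongr
    linarith
  have hk2 : (-1 : ℝ) < k := by
    by_contra hk2
    push Not at hk2
    have : 2 * π * (k : ℝ) ≤ 2 * π * (-1) := by gcongr
    linarith
  have hk0 : k = 0 := by
    have e1 : k < 1 := by exact_mod_cast hk1
    have e2 : -1 < k := by exact_mod_cast hk2
    omega
  subst hk0
  simp only [Int.cast_zero, mul_zero] at hk
  linarith

/-- A lattice vector `D` with `D.2 > 0` and `D.1 + D.2 ≥ 0` has argument at most `2π/3`, so that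
multiplying by `ω` adds `π/3` to its argument. [folklore] -/
theorem arg_omg_mul {D : ℤ × ℤ} (h2 : 0 < D.2) (h12 : 0 ≤ D.1 + D.2) :
    Complex.arg (omg * emb D) = Complex.arg (emb D) + π / 3 := by
  have hD : emb D ≠ 0 := by
    rw [Ne, emb_eq_zero_iff]; rintro rfl; simp at h2
  have him : (omg * emb D).im = ((D.1 + D.2 : ℤ) : ℝ) * (Real.sqrt 3 / 2) := by
    rw [show omg * emb D = -(emb (rot4 D)) by rw [emb_rot4]; ring, Complex.neg_im, emb_im]
    simp only [rot4]; push_cast; ring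
  rw [arg_mul_eq_add_of_im_nonneg omg_ne_zero hD (by rw [omg_im]; positivity)
    (by rw [arg_omg]; linarith [Real.pi_pos]) ?_ ?_, arg_omg, add_comm]
  · rw [emb_im]; have : (0 : ℝ) ≤ (D.2 : ℝ) := by exact_mod_cast h2.le
    positivity
  · rw [him]; have : (0 : ℝ) ≤ ((D.1 + D.2 : ℤ) : ℝ) := by exact_mod_cast h12
    positivity

/-- `cos(9 θ) = cos(π/8)` (`9θ = -15π/8`). [folklore] -/
theorem cos_nine_mul_θ₅ : Real.cos (9 * θ₅) = Real.cos (π / 8) := by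
  rw [show 9 * θ₅ = π / 8 - 2 * π by simp only [θ₅]; ring, Real.cos_sub_two_pi]

/-- `λ⁻⁸ = ω⁻¹ = -ω²`. [folklore] -/
theorem lam_zpow_neg_eight : lam ^ (-8 : ℤ) = -omg ^ 2 := by
  have h3 := omg_pow_three
  rw [show (-8 : ℤ) = -(8 : ℤ) by norm_num, zpow_neg, lam_zpow_eight]
  refine inv_eq_of_mul_eq_one_right ?_
  linear_combination (-1 : ℂ) * h3

/-! ### The triangle `T_L` -/

/-- **The triangle `T_L`** (its vertex set): the triangular cells `(x₀, x₁, b)` with `0 ≤ x₁`,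
`-L ≤ x₀` and `x₀ + x₁ + b ≤ L`, i.e. the `(2L+1)²` cells of the equilateral lattice triangle with
corners the hexagon centres `(-L, 0)`, `(L+1, 0)`, `(-L, 2L+1)` — "an equilateral triangle of
side-length `2L+1`" inscribed in the strip `S_{2L+1}` "in such a way that the midpoint of its
[base] side is `0`" (the base is the boundary line of the half-plane, centred at `a`).
[cite: GlazmanManolescu2019, §4.1 (T_L, Fig. 7)] -/
def triV (L : ℕ) : Finset HV :=
  ((Icc (-(L : ℤ)) L) ×ˢ (Icc (0 : ℤ) (2 * L)) ×ˢ (univ : Finset Bool)).filter fun v =>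
    v.1 + v.2.1 + bit v ≤ L

/-- Membership in `V(T_L)`. [cite: GlazmanManolescu2019, §4.1] -/
theorem mem_triV_iff {L : ℕ} {v : HV} :
    v ∈ triV L ↔ 0 ≤ v.2.1 ∧ -(L : ℤ) ≤ v.1 ∧ v.1 + v.2.1 + bit v ≤ L := by
  obtain ⟨a, b, c⟩ := v
  simp only [triV, mem_filter, mem_product, mem_Icc, mem_univ, and_true]
  cases c <;> simp <;> omega

/-- The triangle lies in the upper half-plane. [cite: GlazmanManolescu2019, §4.1] -/
theorem triV_upper {L : ℕ} : ∀ w ∈ triV L, 0 ≤ w.2.1 := fun _ hw => (mem_triV_iff.1 hw).1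

/-- The origin is a vertex of every triangle. [cite: GlazmanManolescu2019, §4.1] -/
theorem hvOrigin_mem_triV (L : ℕ) : hvOrigin ∈ triV L := by
  rw [mem_triV_iff]; simp [hvOrigin]

/-- The triangles increase with `L` ("all walks contributing to `A^Δ_{2L+1}` also contribute to
`A^Δ_{2L+3}`"). [cite: GlazmanManolescu2019, proof of Lemma 4.1] -/
theorem triV_mono {L L' : ℕ} (h : L ≤ L') : triV L ⊆ triV L' := by
  intro v hv
  rw [mem_triV_iff] at hv ⊢
  omega

/-- `T_L` is inscribed in the strip `S_{2L+1}` (and in every `S_{T,L'}`, `T ≥ 2L+1`, `L' ≥ L`).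
[cite: GlazmanManolescu2019, §4.1 ("inscribe inside it an equilateral triangle")] -/
theorem triV_subset_stripV {L L' T : ℕ} (hT : 2 * L + 1 ≤ T) (hL : L ≤ L') :
    triV L ⊆ stripV T L' := by
  intro v hv
  rw [mem_triV_iff] at hv
  rw [mem_stripV_iff]
  obtain ⟨a, b, c⟩ := v
  cases c <;> simp [lev, bit] at hv ⊢ <;> omega

/-- On `T_L`, `(pos x).1 + (pos x).2 ≤ 3L + 2` (the right side). [cite: GlazmanManolescu2019, §4.1] -/
theorem pos_add_le_of_mem_triV {L : ℕ} {x : HV} (hx : x ∈ triV L) :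
    (pos x).1 + (pos x).2 ≤ 3 * L + 2 := by
  have h := (mem_triV_iff.1 hx).2.2
  obtain ⟨a, b, c⟩ := x; cases c <;> simp [pos, bit] at h ⊢ <;> omega

/-- On `T_L`, `-3L + 1 ≤ (pos x).1` (the left side). [cite: GlazmanManolescu2019, §4.1] -/
theorem le_pos_fst_of_mem_triV {L : ℕ} {x : HV} (hx : x ∈ triV L) :
    -(3 * (L : ℤ)) + 1 ≤ (pos x).1 := by
  have h := (mem_triV_iff.1 hx).2.1
  obtain ⟨a, b, c⟩ := x; cases c <;> simp [pos] at h ⊢ <;> omega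

/-! ### The three classes of boundary half-edges of `T_L` -/

/-- The final half-edge crosses the left side of `T_L`: from `(-L, x₁, false)` to
`(-L-1, x₁, true)` (direction `-2 + ω`, at angle `5π/6`). [cite: GlazmanManolescu2019, §4.1 (Fig. 7)] -/
def IsLeftDart (L : ℕ) (d : HV × HV) : Prop :=
  d.1.1 = -(L : ℤ) ∧ d.1.2.2 = false ∧ d.2 = (d.1.1 - 1, d.1.2.1, true)

/-- The final half-edge crosses the right side of `T_L`: from `(x₀, x₁, false)` with
`x₀ + x₁ = L` to `(x₀, x₁, true)` (direction `1 + ω`, at angle `π/6`).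
[cite: GlazmanManolescu2019, §4.1 (Fig. 7)] -/
def IsRightDart (L : ℕ) (d : HV × HV) : Prop :=
  d.1.1 + d.1.2.1 = L ∧ d.1.2.2 = false ∧ d.2 = (d.1.1, d.1.2.1, true)

/-- Decidability of the left class. [folklore] -/
instance (L : ℕ) : DecidablePred (IsLeftDart L) := fun d => by unfold IsLeftDart; infer_instance
/-- Decidability of the right class. [folklore] -/
instance (L : ℕ) : DecidablePred (IsRightDart L) := fun d => by unfold IsRightDart; infer_instance

/-- **The boundary of `T_L` is base ∪ left side ∪ right side**: a half-edge from a vertex of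
`T_L` leaves the triangle iff it is of class `α` (base), left or right.
[cite: GlazmanManolescu2019, §4.1 (Fig. 7)] -/
theorem not_mem_triV_iff_classes {L : ℕ} {v u : HV} (hv : v ∈ triV L) (hadj : hvGraph.Adj v u) :
    u ∉ triV L ↔ IsAlphaDart (v, u) ∨ IsLeftDart L (v, u) ∨ IsRightDart L (v, u) := by
  obtain ⟨a, b, c⟩ := v
  obtain ⟨a', b', c'⟩ := u
  rw [mem_triV_iff] at hv ⊢
  cases c <;> cases c' <;> simp only [hvGraph_adj, AdjRel] at hadj <;> simp at hadj <;>
    rcases hadj with ⟨rfl, rfl⟩ | ⟨rfl, rfl⟩ | ⟨rfl, rfl⟩ <;>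
    simp [IsAlphaDart, IsLeftDart, IsRightDart, bit] at hv ⊢ <;> omega

/-- The base and left classes are disjoint. [cite: GlazmanManolescu2019, §4.1] -/
theorem not_isLeftDart_of_isAlphaDart {L : ℕ} {d : HV × HV} (h : IsAlphaDart d) :
    ¬ IsLeftDart L d := fun h' => by
  have e := h.2.2; rw [h'.2.2] at e; simp only [Prod.mk.injEq] at e; omega

/-- The base and right classes are disjoint. [cite: GlazmanManolescu2019, §4.1] -/
theorem not_isRightDart_of_isAlphaDart {L : ℕ} {d : HV × HV} (h : IsAlphaDart d) :
    ¬ IsRightDart L d := fun h' => by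
  have e := h.2.2; rw [h'.2.2] at e; simp only [Prod.mk.injEq] at e
  have := h.1; omega

/-- The left and right classes are disjoint. [cite: GlazmanManolescu2019, §4.1] -/
theorem not_isRightDart_of_isLeftDart {L : ℕ} {d : HV × HV} (h : IsLeftDart L d) :
    ¬ IsRightDart L d := fun h' => by
  have e := h.2.2; rw [h'.2.2] at e; simp only [Prod.mk.injEq] at e; omega

/-- For a walk of `T_L` from `a`: it is a nontrivial walk to a boundary mid-edge iff its final
half-edge is of class `α`, left or right. [cite: GlazmanManolescu2019, §4.1] -/
theorem tri_boundary_iff {L : ℕ} {P : List HV} (hP : IsMidWalk (triV L) P) :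
    (P ≠ [wOut, hvOrigin] ∧ (finalDart P).2 ∉ triV L) ↔
      (IsAlphaDart (finalDart P) ∨ IsLeftDart L (finalDart P) ∨ IsRightDart L (finalDart P)) := by
  rcases hP.trivial_or_exists with rfl | ⟨l, u, hl, rfl⟩
  · simp only [ne_eq, not_true_eq_false, false_and, finalDart_trivial, false_iff, not_or]
    refine ⟨fun h => ?_, fun h => ?_, fun h => ?_⟩
    · have := h.1; simp [wOut] at this
    · have := h.2.1; simp [wOut] at this
    · have := h.2.1; simp [wOut] at this
  · obtain ⟨-, -, hadj, hlV, -, -⟩ := (isMidWalk_cons_append_iff _ hl u).1 hP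
    rw [finalDart_cons_append hl]
    rw [← not_mem_triV_iff_classes (hlV _ (List.getLast_mem hl)) hadj]
    have hne : wOut :: (l ++ [u]) ≠ [wOut, hvOrigin] := by
      intro h
      have := congrArg List.length h
      simp only [List.length_cons, List.length_append, List.length_nil] at this
      exact hl (List.eq_nil_of_length_eq_zero (by omega))
    exact ⟨fun h => h.2, fun h => ⟨hne, h⟩⟩

/-! ### Windings to the two far sides -/

section Winding

variable {L : ℕ} {P : List HV}

/-- **Winding to the right side is `-π/3`**: a self-avoiding walk of `T_L` from `a` leaving through
the right side turns in total by `-π/3` (`pturn = -1`): Hopf's formula with the rotation `ω`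
taking the exit direction `1 + ω` to `i√3`; the whole triangle lies behind the right side.
[cite: GlazmanManolescu2019, proof of Lemma 4.1 ("the winding of walks from a to b are all equal if b ∈ β^Δ")] -/
theorem pturn_of_isRightDart (hP : IsMidWalk (triV L) P) (hR : IsRightDart L (finalDart P)) :
    pturn P = -1 := by
  rcases hP.trivial_or_exists with rfl | ⟨l, u, hl, rfl⟩
  · exact absurd hR.2.1 (by simp [finalDart, wOut])
  rw [finalDart_cons_append hl] at hR
  obtain ⟨h1, h2, h3⟩ := hR
  dsimp only at h1 h2 h3
  obtain ⟨-, -, -, hlV, -, -⟩ := (isMidWalk_cons_append_iff _ hl u).1 hP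
  set v := l.getLast hl with hv
  have hvV : v ∈ triV L := hlV _ (List.getLast_mem hl)
  have hb := (mem_triV_iff.1 hvV).1
  have hposv : pos v = (3 * v.1 + 1, 3 * v.2.1 + 1) := by simp [pos, h2]
  have hposu : pos u = (3 * v.1 + 2, 3 * v.2.1 + 2) := by rw [h3]; simp [pos]
  have him : ∀ X : ℤ × ℤ, (omg * emb X).im = ((X.1 + X.2 : ℤ) : ℝ) * (Real.sqrt 3 / 2) := by
    intro X
    rw [show omg * emb X = -(emb (rot4 X)) by rw [emb_rot4]; ring, Complex.neg_im, emb_im]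
    simp only [rot4]; push_cast; ring
  have key := pturn_walk_eq triV_upper hl hP ?_ ?_ ?_ omg_ne_zero (c := omg) ?_ ?_
  · apply int_eq_of_pi_div_three_mul
    rw [key, hposu, pos_wOut, show ((3 * v.1 + 2, 3 * v.2.1 + 2) - (2, -1) : ℤ × ℤ) =
      (3 * v.1, 3 * v.2.1 + 3) by simp only [Prod.mk_sub_mk, Prod.mk.injEq]; constructor <;> ring,
      arg_omg_mul]
    · push_cast; ring
    · dsimp only; omega
    · dsimp only; omega
  · rw [mem_triV_iff, h3]; simp [bit]; omega
  · rw [h3]; simp only [wOut, Ne, Prod.mk.injEq]; omega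
  · rw [hposu]; dsimp only; omega
  · refine forall_mem_walk ?_ (fun x hx => ?_) ?_
    · rw [him, hposu, pos_wOut]; simp only [Prod.fst_sub, Prod.snd_sub]
      have : (0 : ℝ) ≤ ((3 * v.1 + 2 - 2 + (3 * v.2.1 + 2 - (-1)) : ℤ) : ℝ) := by
        exact_mod_cast (by omega)
      positivity
    · rw [him, hposu]; simp only [Prod.fst_sub, Prod.snd_sub]
      have h4 := pos_add_le_of_mem_triV (hlV x hx)
      have : (0 : ℝ) ≤ ((3 * v.1 + 2 - (pos x).1 + (3 * v.2.1 + 2 - (pos x).2) : ℤ) : ℝ) := by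
        exact_mod_cast (by omega)
      positivity
    · rw [sub_self, him]; simp
  · rw [hposu, hposv, show ((3 * v.1 + 2, 3 * v.2.1 + 2) - (3 * v.1 + 1, 3 * v.2.1 + 1) : ℤ × ℤ) =
        (1, 1) by simp only [Prod.mk_sub_mk, Prod.mk.injEq]; constructor <;> ring]
    have e : omg * emb (1, 1) = emb (-1, 2) := by
      have h2' := omg_sq
      simp only [emb]; push_cast
      linear_combination h2'
    rw [e]; exact arg_emb_neg_one_two

/-- **Winding to the left side is `+π/3`**: a self-avoiding walk of `T_L` from `a` leaving through
the left side turns in total by `+π/3` (`pturn = 1`): Hopf's formula with the rotation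
`ω̄ = 1 - ω` taking the exit direction `-2 + ω` to `i√3`; the whole triangle lies behind the left
side. [cite: GlazmanManolescu2019, proof of Lemma 4.1] -/
theorem pturn_of_isLeftDart (hP : IsMidWalk (triV L) P) (hL : IsLeftDart L (finalDart P)) :
    pturn P = 1 := by
  rcases hP.trivial_or_exists with rfl | ⟨l, u, hl, rfl⟩
  · exact absurd hL.2.1 (by simp [finalDart, wOut])
  rw [finalDart_cons_append hl] at hL
  obtain ⟨h1, h2, h3⟩ := hL
  dsimp only at h1 h2 h3
  obtain ⟨-, -, -, hlV, -, -⟩ := (isMidWalk_cons_append_iff _ hl u).1 hP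
  set v := l.getLast hl with hv
  have hvV : v ∈ triV L := hlV _ (List.getLast_mem hl)
  have hb := (mem_triV_iff.1 hvV).1
  have hposv : pos v = (3 * v.1 + 1, 3 * v.2.1 + 1) := by simp [pos, h2]
  have hposu : pos u = (3 * v.1 - 1, 3 * v.2.1 + 2) := by rw [h3]; simp [pos]; ring
  have him : ∀ X : ℤ × ℤ, ((1 - omg) * emb X).im = ((-X.1 : ℤ) : ℝ) * (Real.sqrt 3 / 2) := by
    intro X
    rw [show (1 - omg) * emb X = emb X + emb (rot4 X) by rw [emb_rot4]; ring, Complex.add_im,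
      emb_im, emb_im]
    simp only [rot4]; push_cast; ring
  have key := pturn_walk_eq triV_upper hl hP ?_ ?_ ?_ one_sub_omg_ne_zero (c := 1 - omg) ?_ ?_
  · apply int_eq_of_pi_div_three_mul
    rw [key, arg_one_sub_omg_mul]
    · push_cast; ring
    · rw [Ne, emb_eq_zero_iff, hposu, pos_wOut]; simp; omega
    · rw [emb_im, hposu, pos_wOut]; simp only [Prod.snd_sub]
      have : (0 : ℝ) ≤ ((3 * v.2.1 + 2 - (-1) : ℤ) : ℝ) := by exact_mod_cast (by omega)
      positivity
  · rw [mem_triV_iff, h3]; simp; omega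
  · rw [h3]; simp only [wOut, Ne, Prod.mk.injEq]; omega
  · rw [hposu]; dsimp only; omega
  · refine forall_mem_walk ?_ (fun x hx => ?_) ?_
    · rw [him, hposu, pos_wOut]; simp only [Prod.fst_sub]
      have : (0 : ℝ) ≤ ((-(3 * v.1 - 1 - 2) : ℤ) : ℝ) := by exact_mod_cast (by omega)
      positivity
    · rw [him, hposu]; simp only [Prod.fst_sub]
      have h4 := le_pos_fst_of_mem_triV (hlV x hx)
      have : (0 : ℝ) ≤ ((-(3 * v.1 - 1 - (pos x).1)) : ℤ) := by exact_mod_cast (by omega)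
      positivity
    · rw [sub_self, him]; simp
  · rw [hposu, hposv, show ((3 * v.1 - 1, 3 * v.2.1 + 2) - (3 * v.1 + 1, 3 * v.2.1 + 1) : ℤ × ℤ) =
        (-2, 1) by simp only [Prod.mk_sub_mk, Prod.mk.injEq]; constructor <;> ring]
    have e : (1 - omg) * emb (-2, 1) = emb (-1, 2) := by
      have h2' := omg_sq
      simp only [emb]; push_cast
      linear_combination -h2'
    rw [e]; exact arg_emb_neg_one_two

/-- **Boundary term on the right side**: direction `1 + ω = ω̄ e₀`, winding `-π/3`: the real
part of the term is `cos(π/8)` ("each walk ending on `β^Δ_{2L+1}` has total weight `cos(π/8)`").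
[cite: GlazmanManolescu2019, §4.1 (caption of Fig. 7)] -/
theorem boundaryTerm_re_of_isRightDart (hP : IsMidWalk (triV L) P)
    (hR : IsRightDart L (finalDart P)) :
    (edir (finalDart P).1 (finalDart P).2 * lam ^ pturn P / emb (-1, 2)).re = Real.cos (π / 8) := by
  have h0 := pturn_of_isRightDart hP hR
  rcases hP.trivial_or_exists with rfl | ⟨l, u, hl, rfl⟩
  · exact absurd hR.2.1 (by simp [finalDart, wOut])
  rw [h0, finalDart_cons_append hl]
  rw [finalDart_cons_append hl] at hR
  obtain ⟨-, h2, h3⟩ := hR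
  dsimp only at h2 h3 ⊢
  have he : edir (l.getLast hl) u = lam ^ (-8 : ℤ) * emb (-1, 2) := by
    rw [lam_zpow_neg_eight, edir, h3,
      show pos (l.getLast hl) = (3 * (l.getLast hl).1 + 1, 3 * (l.getLast hl).2.1 + 1) by
        simp [pos, h2]]
    simp only [pos, if_true]
    rw [show ((3 * (l.getLast hl).1 + 2, 3 * (l.getLast hl).2.1 + 2) -
        (3 * (l.getLast hl).1 + 1, 3 * (l.getLast hl).2.1 + 1) : ℤ × ℤ) = (1, 1) by
      simp only [Prod.mk_sub_mk, Prod.mk.injEq]; constructor <;> ring]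
    have h2' := omg_sq
    have h3' := omg_pow_three
    simp only [emb]; push_cast
    linear_combination (-1 : ℂ) * h2' + 2 * h3'
  rw [he, mul_div_right_comm, mul_div_assoc, div_self emb_neg_one_two_ne_zero, mul_one,
    ← zpow_add₀ lam_ne_zero, lam_zpow_re, show (((-8 + -1 : ℤ)) : ℝ) * θ₅ = -(9 * θ₅) by
      push_cast; ring, Real.cos_neg]
  exact cos_nine_mul_θ₅

/-- **Boundary term on the left side**: direction `-2 + ω = ω e₀`, winding `+π/3`: the real part
of the term is `cos(π/8)`. [cite: GlazmanManolescu2019, §4.1 (caption of Fig. 7)] -/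
theorem boundaryTerm_re_of_isLeftDart (hP : IsMidWalk (triV L) P)
    (hL : IsLeftDart L (finalDart P)) :
    (edir (finalDart P).1 (finalDart P).2 * lam ^ pturn P / emb (-1, 2)).re = Real.cos (π / 8) := by
  have h0 := pturn_of_isLeftDart hP hL
  rcases hP.trivial_or_exists with rfl | ⟨l, u, hl, rfl⟩
  · exact absurd hL.2.1 (by simp [finalDart, wOut])
  rw [h0, finalDart_cons_append hl]
  rw [finalDart_cons_append hl] at hL
  obtain ⟨-, h2, h3⟩ := hL
  dsimp only at h2 h3 ⊢
  have he : edir (l.getLast hl) u = lam ^ (8 : ℤ) * emb (-1, 2) := by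
    rw [lam_zpow_eight, edir, h3,
      show pos (l.getLast hl) = (3 * (l.getLast hl).1 + 1, 3 * (l.getLast hl).2.1 + 1) by
        simp [pos, h2]]
    simp only [pos, if_true]
    rw [show ((3 * ((l.getLast hl).1 - 1) + 2, 3 * (l.getLast hl).2.1 + 2) -
        (3 * (l.getLast hl).1 + 1, 3 * (l.getLast hl).2.1 + 1) : ℤ × ℤ) = (-2, 1) by
      simp only [Prod.mk_sub_mk, Prod.mk.injEq]; constructor <;> ring]
    have h2' := omg_sq
    simp only [emb]; push_cast
    linear_combination (-2 : ℂ) * h2'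
  rw [he, mul_div_right_comm, mul_div_assoc, div_self emb_neg_one_two_ne_zero, mul_one,
    ← zpow_add₀ lam_ne_zero, lam_zpow_re, show (((8 + 1 : ℤ)) : ℝ) = 9 by norm_num]
  exact cos_nine_mul_θ₅

end Winding

/-! ### The partition functions of the triangle and the identity of Lemma 4.1 -/

/-- **`A^Δ_{2L+1}`**: "the partition function of walks starting at `0`, contained in the triangle,
and ending on its left side" (our base: the boundary line of the half-plane), at `x = x_c`; the
empty walk excluded. [cite: GlazmanManolescu2019, §4.1 (A^Δ)] -/
def triA (L : ℕ) : ℝ :=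
  ∑ P ∈ (midWalks (triV L)).filter (fun P => IsAlphaDart (finalDart P)),
    hexCriticalFugacity ^ mwLen P

/-- **The left half of `D^Δ_{2L+1}`**: the partition function of walks of `T_L` from `a` ending on
the left side (`= Σ_K Δ^Δ_{L,K}`). [cite: GlazmanManolescu2019, §4.1 (D^Δ, Δ^Δ_{L,K})] -/
def triDl (L : ℕ) : ℝ :=
  ∑ P ∈ (midWalks (triV L)).filter (fun P => IsLeftDart L (finalDart P)),
    hexCriticalFugacity ^ mwLen P

/-- **The right half of `D^Δ_{2L+1}`**: the partition function of walks of `T_L` from `a` ending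
on the right side. [cite: GlazmanManolescu2019, §4.1 (D^Δ)] -/
def triDr (L : ℕ) : ℝ :=
  ∑ P ∈ (midWalks (triV L)).filter (fun P => IsRightDart L (finalDart P)),
    hexCriticalFugacity ^ mwLen P

/-- `A^Δ ≥ 0`. [cite: GlazmanManolescu2019, §4.1] -/
theorem triA_nonneg (L : ℕ) : 0 ≤ triA L :=
  sum_nonneg fun _ _ => pow_nonneg hexCriticalFugacity_pos_lt_one.1.le _

/-- `triDl ≥ 0`. [cite: GlazmanManolescu2019, §4.1] -/
theorem triDl_nonneg (L : ℕ) : 0 ≤ triDl L :=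
  sum_nonneg fun _ _ => pow_nonneg hexCriticalFugacity_pos_lt_one.1.le _

/-- `triDr ≥ 0`. [cite: GlazmanManolescu2019, §4.1] -/
theorem triDr_nonneg (L : ℕ) : 0 ≤ triDr L :=
  sum_nonneg fun _ _ => pow_nonneg hexCriticalFugacity_pos_lt_one.1.le _

/-- **Glazman–Manolescu, Lemma 4.1 (the identity)**: "By summing the real part of (CR) [over the
triangle] we obtain `cos(3π/8) A^Δ_{2L+1} + cos(π/8) D^Δ_{2L+1} = 1`." Here from the summed vertex
relation `HV.boundary_sum` (Duminil-Copin–Smirnov's Lemma 1 over `V(T_L)`), the classification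
`tri_boundary_iff` and the boundary windings `∓π` (base), `±π/3` (far sides).
[cite: GlazmanManolescu2019, Lemma 4.1 (proof)] -/
theorem tri_identity (L : ℕ) :
    Real.cos (3 * π / 8) * triA L + Real.cos (π / 8) * (triDl L + triDr L) = 1 := by
  have hbs := boundary_sum (V := triV L) triV_upper (hvOrigin_mem_triV L)
  rw [edir_wOut_hvOrigin, Finset.sum_filter] at hbs
  have hsub : triV L ⊆ stripV (2 * L + 1) L := triV_subset_stripV le_rfl le_rfl
  have hpt : ∀ P ∈ midWalks (triV L),
      ((if P ≠ [wOut, hvOrigin] ∧ (finalDart P).2 ∉ triV L then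
          edir (finalDart P).1 (finalDart P).2 * pwt P else 0) / emb (-1, 2)).re =
        hexCriticalFugacity ^ mwLen P *
          ((if IsAlphaDart (finalDart P) then Real.cos (3 * π / 8) else 0) +
            (if IsLeftDart L (finalDart P) then Real.cos (π / 8) else 0) +
            (if IsRightDart L (finalDart P) then Real.cos (π / 8) else 0)) := by
    intro P hP
    rw [mem_midWalks_iff] at hP
    have hiff := tri_boundary_iff hP
    by_cases hα : IsAlphaDart (finalDart P)
    · rw [if_pos (hiff.2 (Or.inl hα)), re_div_e₀, boundaryTerm_re_of_isAlphaDart (hP.mono hsub) hα,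
        if_pos hα, if_neg (not_isLeftDart_of_isAlphaDart hα),
        if_neg (not_isRightDart_of_isAlphaDart hα)]
      ring
    by_cases hl : IsLeftDart L (finalDart P)
    · rw [if_pos (hiff.2 (Or.inr (Or.inl hl))), re_div_e₀, boundaryTerm_re_of_isLeftDart hP hl,
        if_neg hα, if_pos hl, if_neg (not_isRightDart_of_isLeftDart hl)]
      ring
    by_cases hr : IsRightDart L (finalDart P)
    · rw [if_pos (hiff.2 (Or.inr (Or.inr hr))), re_div_e₀, boundaryTerm_re_of_isRightDart hP hr,
        if_neg hα, if_neg hl, if_pos hr]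
      ring
    · rw [if_neg (by rw [hiff]; push Not; exact ⟨hα, hl, hr⟩), zero_div, Complex.zero_re,
        if_neg hα, if_neg hl, if_neg hr]
      ring
  have key := congrArg (fun z => (z / emb (-1, 2)).re) hbs
  rw [div_self emb_neg_one_two_ne_zero, Complex.one_re, Finset.sum_div, Complex.re_sum,
    Finset.sum_congr rfl hpt] at key
  have hA : ∑ P ∈ midWalks (triV L), hexCriticalFugacity ^ mwLen P *
      (if IsAlphaDart (finalDart P) then Real.cos (3 * π / 8) else 0) =
        Real.cos (3 * π / 8) * triA L := by
    rw [triA, Finset.mul_sum, Finset.sum_filter]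
    refine Finset.sum_congr rfl fun P _ => ?_
    split_ifs <;> ring
  have hDl : ∑ P ∈ midWalks (triV L), hexCriticalFugacity ^ mwLen P *
      (if IsLeftDart L (finalDart P) then Real.cos (π / 8) else 0) =
        Real.cos (π / 8) * triDl L := by
    rw [triDl, Finset.mul_sum, Finset.sum_filter]
    refine Finset.sum_congr rfl fun P _ => ?_
    split_ifs <;> ring
  have hDr : ∑ P ∈ midWalks (triV L), hexCriticalFugacity ^ mwLen P *
      (if IsRightDart L (finalDart P) then Real.cos (π / 8) else 0) =
        Real.cos (π / 8) * triDr L := by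
    rw [triDr, Finset.mul_sum, Finset.sum_filter]
    refine Finset.sum_congr rfl fun P _ => ?_
    split_ifs <;> ring
  rw [mul_add, ← key, ← hA, ← hDl, ← hDr, ← Finset.sum_add_distrib, ← Finset.sum_add_distrib]
  refine Finset.sum_congr rfl fun P _ => ?_
  ring

/-! ### The reflection symmetry of the triangle: `D^Δ = 2 · (left half)` -/

/-- **The reflection of `ℍ` in the vertical axis through `a`**: `(x₀, x₁, b) ↦ (-x₀ - x₁ - b, x₁, b)`,
a graph automorphism fixing `w` and `O` ("by vertical symmetry", in the paper's orientation).
[cite: GlazmanManolescu2019, §4.1 ("by vertical symmetry")] -/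
def reflT : hvGraph ≃g hvGraph where
  toFun v := (-v.1 - v.2.1 - bit v, v.2.1, v.2.2)
  invFun v := (-v.1 - v.2.1 - bit v, v.2.1, v.2.2)
  left_inv v := by
    obtain ⟨a, b, c⟩ := v
    refine Prod.ext ?_ (Prod.ext rfl rfl)
    cases c <;> simp only [bit_true, bit_false] <;> omega
  right_inv v := by
    obtain ⟨a, b, c⟩ := v
    refine Prod.ext ?_ (Prod.ext rfl rfl)
    cases c <;> simp only [bit_true, bit_false] <;> omega
  map_rel_iff' := by
    intro u v
    obtain ⟨a, b, c⟩ := u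
    obtain ⟨a', b', c'⟩ := v
    cases c <;> cases c' <;> simp [hvGraph_adj, AdjRel, bit] <;> omega

/-- The reflection in coordinates. [folklore] -/
@[simp] theorem reflT_apply (v : HV) : reflT v = (-v.1 - v.2.1 - bit v, v.2.1, v.2.2) := rfl

/-- The reflection is an involution. [folklore] -/
@[simp] theorem reflT_reflT (v : HV) : reflT (reflT v) = v := reflT.left_inv v

/-- The reflection fixes `w`. [folklore] -/
@[simp] theorem reflT_wOut : reflT wOut = wOut := by decide

/-- The reflection fixes `O`. [folklore] -/
@[simp] theorem reflT_hvOrigin : reflT hvOrigin = hvOrigin := by decide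

/-- The reflection preserves the triangle. [cite: GlazmanManolescu2019, §4.1] -/
theorem reflT_mem_triV_iff {L : ℕ} (v : HV) : reflT v ∈ triV L ↔ v ∈ triV L := by
  obtain ⟨a, b, c⟩ := v
  rw [mem_triV_iff, mem_triV_iff]
  cases c <;> simp [bit] <;> omega

/-- `inner` commutes with `map`. [folklore] -/
theorem inner_map (f : HV → HV) (P : List HV) : inner (P.map f) = (inner P).map f := by
  simp [inner, List.map_tail, List.map_dropLast]

/-- A graph automorphism of `ℍ` fixing `w` and `O` transports mid-edge walks.
[folklore] -/
theorem IsMidWalk.map_iso {V W : Finset HV} (φ : hvGraph ≃g hvGraph) (hw : φ wOut = wOut)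
    (hO : φ hvOrigin = hvOrigin) (hVW : ∀ x ∈ V, φ x ∈ W) {P : List HV} (hP : IsMidWalk V P) :
    IsMidWalk W (P.map φ) := by
  obtain ⟨hc, hh, ht, hV, hnd, hne⟩ := hP
  refine ⟨?_, ?_, ?_, ?_, ?_, ?_⟩
  · rw [List.isChain_map]; exact hc.imp fun x y h => φ.map_rel_iff.2 h
  · rw [List.head?_map, hh]; simp [hw]
  · rw [← List.map_tail, List.head?_map, ht]; simp [hO]
  · intro x hx
    rw [inner_map, List.mem_map] at hx
    obtain ⟨y, hy, rfl⟩ := hx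
    exact hVW y (hV y hy)
  · rw [inner_map]; exact hnd.map φ.injective
  · rw [← List.map_dropLast, ← List.map_dropLast, List.getLast?_map, List.getLast?_map]
    intro h
    exact hne (Option.map_injective φ.injective h)

/-- The final dart of a transported walk (the automorphism fixing `w`). [folklore] -/
theorem finalDart_map_iso (φ : hvGraph ≃g hvGraph) (hw : φ wOut = wOut) (P : List HV) :
    finalDart (P.map φ) = (φ (finalDart P).1, φ (finalDart P).2) := by
  have key : ∀ o : Option HV, (o.map φ).getD wOut = φ (o.getD wOut) := by
    intro o; cases o <;> simp [hw]
  simp only [finalDart, ← List.map_dropLast, List.getLast?_map, key]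

/-- Transport does not change the length. [folklore] -/
@[simp] theorem mwLen_map (f : HV → HV) (P : List HV) : mwLen (P.map f) = mwLen P := by
  simp [mwLen]

/-- The reflection takes left exits to right exits. [cite: GlazmanManolescu2019, §4.1] -/
theorem isRightDart_reflT_of_isLeftDart {L : ℕ} {d : HV × HV} (h : IsLeftDart L d) :
    IsRightDart L (reflT d.1, reflT d.2) := by
  obtain ⟨⟨a, b, c⟩, u⟩ := d
  obtain ⟨h1, h2, h3⟩ := h
  dsimp only at h1 h2 h3
  subst h2; subst h3
  refine ⟨?_, rfl, ?_⟩
  · simp only [reflT_apply, bit_false]; omega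
  · simp only [reflT_apply, bit_false, bit_true, Prod.mk.injEq, and_true]; omega

/-- The reflection takes right exits to left exits. [cite: GlazmanManolescu2019, §4.1] -/
theorem isLeftDart_reflT_of_isRightDart {L : ℕ} {d : HV × HV} (h : IsRightDart L d) :
    IsLeftDart L (reflT d.1, reflT d.2) := by
  obtain ⟨⟨a, b, c⟩, u⟩ := d
  obtain ⟨h1, h2, h3⟩ := h
  dsimp only at h1 h2 h3
  subst h2; subst h3
  refine ⟨?_, rfl, ?_⟩
  · simp only [reflT_apply, bit_false]; omega
  · simp only [reflT_apply, bit_false, bit_true, Prod.mk.injEq, and_true]; omega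

/-- **`D^Δ` is twice its left half** ("by vertical symmetry"): the reflection `reflT` is a
weight-preserving bijection between the walks of `T_L` to the left side and those to the right
side. [cite: GlazmanManolescu2019, §4.1 ("D^Δ_{2L+1} = 2 Σ_K Δ^Δ_{L,K}")] -/
theorem triDl_eq_triDr (L : ℕ) : triDl L = triDr L := by
  have hmapV : ∀ x ∈ triV L, reflT x ∈ triV L := fun x hx => (reflT_mem_triV_iff x).2 hx
  have hinj : ∀ s : Finset (List HV), Set.InjOn (fun P : List HV => P.map reflT) s :=
    fun s => (List.map_injective_iff.2 reflT.injective).injOn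
  have h0 := hexCriticalFugacity_pos_lt_one.1.le
  apply le_antisymm
  · -- left ≤ right
    unfold triDl triDr
    have key := sum_le_sum_of_injOn_of_nonneg
      (s := (midWalks (triV L)).filter fun P => IsLeftDart L (finalDart P))
      (t := (midWalks (triV L)).filter fun P => IsRightDart L (finalDart P))
      (fun P : List HV => P.map reflT) (hinj _) ?_
      (fun P => hexCriticalFugacity ^ mwLen P) (fun _ _ => pow_nonneg h0 _)
    · simpa only [mwLen_map] using key
    · intro P hP
      rw [mem_filter, mem_midWalks_iff] at hP ⊢
      refine ⟨hP.1.map_iso reflT reflT_wOut reflT_hvOrigin hmapV, ?_⟩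
      rw [finalDart_map_iso reflT reflT_wOut]
      exact isRightDart_reflT_of_isLeftDart hP.2
  · unfold triDl triDr
    have key := sum_le_sum_of_injOn_of_nonneg
      (s := (midWalks (triV L)).filter fun P => IsRightDart L (finalDart P))
      (t := (midWalks (triV L)).filter fun P => IsLeftDart L (finalDart P))
      (fun P : List HV => P.map reflT) (hinj _) ?_
      (fun P => hexCriticalFugacity ^ mwLen P) (fun _ _ => pow_nonneg h0 _)
    · simpa only [mwLen_map] using key
    · intro P hP
      rw [mem_filter, mem_midWalks_iff] at hP ⊢
      refine ⟨hP.1.map_iso reflT reflT_wOut reflT_hvOrigin hmapV, ?_⟩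
      rw [finalDart_map_iso reflT reflT_wOut]
      exact isLeftDart_reflT_of_isRightDart hP.2

/-- Lemma 4.1's identity with the symmetry inserted: `cos(3π/8) A^Δ + 2 cos(π/8) · triDl = 1`.
[cite: GlazmanManolescu2019, Lemma 4.1] -/
theorem tri_identity' (L : ℕ) :
    Real.cos (3 * π / 8) * triA L + 2 * Real.cos (π / 8) * triDl L = 1 := by
  have h := tri_identity L
  rw [← triDl_eq_triDr] at h
  linarith

/-! ### Monotonicity in `L` and comparison with the strip -/

/-- **`A^Δ` is non-decreasing in `L`**: "All walks contributing to `A^Δ_{2L+1}` also contribute to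
`A^Δ_{2L+3}`." [cite: GlazmanManolescu2019, proof of Lemma 4.1] -/
theorem triA_mono {L L' : ℕ} (h : L ≤ L') : triA L ≤ triA L' := by
  unfold triA
  apply sum_le_sum_of_subset_of_nonneg
  · intro P hP
    rw [mem_filter] at hP ⊢
    exact ⟨midWalks_mono (triV_mono h) hP.1, hP.2⟩
  · exact fun _ _ _ => pow_nonneg hexCriticalFugacity_pos_lt_one.1.le _

/-- `cos(π/8) > 0`. [folklore] -/
theorem cos_pi_div_eight_pos : 0 < Real.cos (π / 8) := by
  apply Real.cos_pos_of_mem_Ioo; constructor <;> linarith [Real.pi_pos]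

/-- **`D^Δ` is non-increasing in `L`** (by the identity and the monotonicity of `A^Δ`).
[cite: GlazmanManolescu2019, Lemma 4.1 ("D^Δ_{2L+1} is decreasing in L")] -/
theorem triDl_antitone {L L' : ℕ} (h : L ≤ L') : triDl L' ≤ triDl L := by
  have h1 := tri_identity' L
  have h2 := tri_identity' L'
  have hA := triA_mono h
  have hc := cos_pi_div_eight_pos
  have hc' := cos_three_pi_div_eight_pos
  nlinarith

/-- **`A^Δ_{2L+1} ≤ A_{T,L'}`** for `T ≥ 2L+1`, `L' ≥ L`: "the latter partition function is over
a larger set of walks". [cite: GlazmanManolescu2019, proof of Lemma 4.1] -/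
theorem triA_le_stripA {L L' T : ℕ} (hT : 2 * L + 1 ≤ T) (hL : L ≤ L') :
    triA L ≤ stripA T L' hexCriticalFugacity := by
  unfold triA stripA
  apply sum_le_sum_of_subset_of_nonneg
  · intro P hP
    rw [mem_filter] at hP ⊢
    exact ⟨midWalks_mono (triV_subset_stripV hT hL) hP.1, hP.2⟩
  · exact fun _ _ _ => pow_nonneg hexCriticalFugacity_pos_lt_one.1.le _

/-- **Glazman–Manolescu, Lemma 4.1, eq. (4.1): `B_T ≤ cos(π/8) D^Δ`**, in finite volume: for every
`T ≥ 2L+1` and every `L'`, `B_{T,L'}(x_c) ≤ 2 cos(π/8) · triDl L`. Proof as printed: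
`B_{T,L'} ≤ 1 - cos(3π/8) A_{T,L'}` (Duminil-Copin–Smirnov's Lemma 2, `E_{T,L'} ≥ 0`; enlarging `L'`
first if `L' < L`), `A_{T,L'} ≥ A^Δ_{2L+1}`, and the identity of Lemma 4.1.
[cite: GlazmanManolescu2019, Lemma 4.1, eq. (4.1)] -/
theorem stripB_le_triDl {L T : ℕ} (hT : 2 * L + 1 ≤ T) (L' : ℕ) :
    stripB T L' hexCriticalFugacity ≤ 2 * Real.cos (π / 8) * triDl L := by
  have h0 := hexCriticalFugacity_pos_lt_one.1.le
  have hT1 : 1 ≤ T := by omega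
  set M := max L L' with hM
  have hmono : stripB T L' hexCriticalFugacity ≤ stripB T M hexCriticalFugacity :=
    stripB_mono_L h0 (le_max_right _ _)
  have hlem := DuminilCopinSmirnov2012_lemma2_holds T M hT1
  have hE := stripE_nonneg (T := T) (L := M) h0
  have hA := triA_le_stripA (T := T) hT (le_max_left L L')
  have hid := tri_identity' L
  have hc := cos_three_pi_div_eight_pos
  have hc' := cos_pi_div_four_pos'
  rw [← hM] at hA
  nlinarith

end HV

end Literature.Probability.RandomPlanarGeometry.SAW
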